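import Literature.GroupTheory.CombinatorialGroupTheory.PuncturedSurfaceGroupFreeBasis
import HarnessLib

/-!
# Three free bases of `Γ_{0,4}` adapted to the degenerate four-pointed line (two tripods glued at a node)

`Γ_{0,4} = ⟨c₀, c₁, c₂, c₃ ∣ c₀c₁c₂c₃⟩` (`PuncturedSurfaceGroup 0 4`, generators `c j`, `j : Fin 4`) is free
on `c₁, c₂, c₃` (`freeEquiv 0 3`, [SemiAnbd] Ex. 2.10 [cite: MochizukiSemiAnbd2006, Ex. 2.10 p.31]).
For the dual semi-graph of the stable curve obtained by gluing two tripods at a node — cusps `c₁, c₂`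
on one component, `c₃, c₀` on the other, node `e` with `Π_e` generated by `c₁c₂ = (c₃c₀)⁻¹` — the
verticial, nodal and cuspidal subgroups are closures of SUB-BASIS subgroups for the following free bases
of `Γ_{0,4}` (all obtained from `c₁, c₂, c₃` by Nielsen transformations, here by explicit mutually
inverse lifts):

* `exists_freeGroupBasis_node` — `(c₁, c₁c₂, c₃)`: vertices `{0,1}` / `{1,2}`, node `{1}`, cusps
  `c₁ = {0}`, `c₃ = {2}`;
* `exists_freeGroupBasis_node_two` — `(c₁c₂, c₂, c₃)`: node `{0}`, cusp `c₂ = {1}`, second vertex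
  `{0,2}`;
* `exists_freeGroupBasis_node_zero` — `(c₁, c₁c₂, c₁c₂c₃)` with `c₁c₂c₃ = c₀⁻¹`: node `{1}`, cusp
  `c₀ = {2}` (as `⟨c₀⟩ = ⟨c₀⁻¹⟩`), first vertex `{0,1}`;

together with the relation `c_zero_mul : c₀ c₁ c₂ c₃ = 1` and the generic tool
`exists_freeGroupBasis_of_lifts` (a basis with prescribed members from a pair of mutually inverse
assignments).  Theorems only; elementary combinatorial group theory (consumed by the [CombGC] §1
two-vertex instance in `Literature/AnabelianGeometry/SemiGraphs/`).
-/

namespace Literature.GroupTheory.CombinatorialGroupTheory.PuncturedSurfaceGroup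

/-- Evaluation of `b.lift f` on a basis element (local copy). [cite: MochizukiSemiAnbd2006, Ex. 2.10 p.31] -/
private theorem lift_apply_basis' {ι G H : Type*} [Group G] [Group H] (b : FreeGroupBasis ι G)
    (f : ι → H) (i : ι) : b.lift f (b i) = f i := by
  change FreeGroup.lift f (b.repr (b i)) = f i
  rw [FreeGroupBasis.repr_apply_coe, FreeGroup.lift_apply_of]

/-- **A free basis with prescribed members.**  If `f, g : ι → G` are assignments whose lifts along a free
basis `b` are mutually inverse on the basis (`b.lift g (f i) = b i = b.lift f (g i)`), then `f` is (the
family of members of) a free basis of `G`. [cite: MochizukiSemiAnbd2006, Ex. 2.10 p.31] -/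
theorem exists_freeGroupBasis_of_lifts {ι G : Type*} [Group G] (b : FreeGroupBasis ι G) (f g : ι → G)
    (hgf : ∀ i, b.lift g (f i) = b i) (hfg : ∀ i, b.lift f (g i) = b i) :
    ∃ b' : FreeGroupBasis ι G, ∀ i, b' i = f i := by
  have h1 : (b.lift g).comp (b.lift f) = MonoidHom.id G :=
    b.ext_hom _ _ fun i => by rw [MonoidHom.comp_apply, lift_apply_basis', hgf]; rfl
  have h2 : (b.lift f).comp (b.lift g) = MonoidHom.id G :=
    b.ext_hom _ _ fun i => by rw [MonoidHom.comp_apply, lift_apply_basis', hfg]; rfl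
  refine ⟨b.map (MonoidHom.toMulEquiv (b.lift f) (b.lift g) h1 h2), fun i => ?_⟩
  rw [FreeGroupBasis.map_apply, MonoidHom.toMulEquiv_apply, lift_apply_basis']

/-- The standard free basis `(c₁, c₂, c₃)` of `Γ_{0,4}` indexed by `Fin 3` (`j ↦ c_{j+1}`), from
`freeEquiv 0 3`. [cite: MochizukiSemiAnbd2006, Ex. 2.10 p.31] -/
theorem exists_freeGroupBasis_succ :
    ∃ b : FreeGroupBasis (Fin 3) (PuncturedSurfaceGroup 0 4), ∀ j, b j = c (Fin.succ j) := by
  refine ⟨(FreeGroupBasis.ofRepr (freeEquiv 0 3)).reindex (Equiv.emptySum (Fin 0 × Bool) (Fin 3)),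
    fun j => ?_⟩
  rw [FreeGroupBasis.reindex_apply]
  have he : (Equiv.emptySum (Fin 0 × Bool) (Fin 3)).symm j = Sum.inr j := by
    apply (Equiv.emptySum (Fin 0 × Bool) (Fin 3)).injective
    rw [Equiv.apply_symm_apply, Equiv.emptySum_apply_inr]
  rw [he]
  change (freeEquiv 0 3).symm (FreeGroup.of (Sum.inr j)) = c (Fin.succ j)
  exact freeEquiv_symm_of_inr j

/-- The relation of `Γ_{0,4}`: `c₀ c₁ c₂ c₃ = 1`. [cite: MochizukiSemiAnbd2006, Ex. 2.10 p.31] -/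
theorem c_zero_mul : (c 0 : PuncturedSurfaceGroup 0 4) * c 1 * c 2 * c 3 = 1 := by
  have h1 := PresentedGroup.one_of_mem
    (rels := ({relator 0 4} : Set (FreeGroup (puncturedSurfaceGen 0 4))))
    (Set.mem_singleton (relator 0 4))
  have e4 : List.finRange 4 = [0, 1, 2, 3] := by decide
  have h2 : relator 0 4 = genC 0 * genC 1 * genC 2 * genC 3 := by
    simp [relator, e4, mul_assoc]
  rw [h2, map_mul, map_mul, map_mul] at h1
  exact h1

/-- `c₀ = (c₁ c₂ c₃)⁻¹` in `Γ_{0,4}`. [cite: MochizukiSemiAnbd2006, Ex. 2.10 p.31] -/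
theorem c_zero_eq_inv : (c 0 : PuncturedSurfaceGroup 0 4) = (c 1 * c 2 * c 3)⁻¹ := by
  have h := c_zero_mul
  rw [eq_inv_iff_mul_eq_one]
  simpa [mul_assoc] using h

/-- **Basis `(c₁, c₁c₂, c₃)`** of `Γ_{0,4}`. [cite: MochizukiSemiAnbd2006, Ex. 2.10 p.31] -/
theorem exists_freeGroupBasis_node :
    ∃ b : FreeGroupBasis (Fin 3) (PuncturedSurfaceGroup 0 4),
      b 0 = c 1 ∧ b 1 = c 1 * c 2 ∧ b 2 = c 3 := by
  obtain ⟨b₀, hb₀⟩ := exists_freeGroupBasis_succ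
  obtain ⟨b, hb⟩ := exists_freeGroupBasis_of_lifts b₀ ![b₀ 0, b₀ 0 * b₀ 1, b₀ 2]
    ![b₀ 0, (b₀ 0)⁻¹ * b₀ 1, b₀ 2]
    (fun i => by fin_cases i <;> simp)
    (fun i => by fin_cases i <;> simp)
  refine ⟨b, ?_, ?_, ?_⟩
  · rw [hb]; simp [hb₀]
  · rw [hb]; simp [hb₀]
  · rw [hb]; simp [hb₀]

/-- **Basis `(c₁c₂, c₂, c₃)`** of `Γ_{0,4}`. [cite: MochizukiSemiAnbd2006, Ex. 2.10 p.31] -/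
theorem exists_freeGroupBasis_node_two :
    ∃ b : FreeGroupBasis (Fin 3) (PuncturedSurfaceGroup 0 4),
      b 0 = c 1 * c 2 ∧ b 1 = c 2 ∧ b 2 = c 3 := by
  obtain ⟨b₀, hb₀⟩ := exists_freeGroupBasis_succ
  obtain ⟨b, hb⟩ := exists_freeGroupBasis_of_lifts b₀ ![b₀ 0 * b₀ 1, b₀ 1, b₀ 2]
    ![b₀ 0 * (b₀ 1)⁻¹, b₀ 1, b₀ 2]
    (fun i => by fin_cases i <;> simp)
    (fun i => by fin_cases i <;> simp)
  refine ⟨b, ?_, ?_, ?_⟩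
  · rw [hb]; simp [hb₀]
  · rw [hb]; simp [hb₀]
  · rw [hb]; simp [hb₀]

/-- **Basis `(c₁, c₁c₂, c₁c₂c₃)`** of `Γ_{0,4}`; its last member is `c₀⁻¹`.
[cite: MochizukiSemiAnbd2006, Ex. 2.10 p.31] -/
theorem exists_freeGroupBasis_node_zero :
    ∃ b : FreeGroupBasis (Fin 3) (PuncturedSurfaceGroup 0 4),
      b 0 = c 1 ∧ b 1 = c 1 * c 2 ∧ b 2 = (c 0)⁻¹ := by
  obtain ⟨b₀, hb₀⟩ := exists_freeGroupBasis_succ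
  obtain ⟨b, hb⟩ := exists_freeGroupBasis_of_lifts b₀ ![b₀ 0, b₀ 0 * b₀ 1, b₀ 0 * b₀ 1 * b₀ 2]
    ![b₀ 0, (b₀ 0)⁻¹ * b₀ 1, (b₀ 1)⁻¹ * b₀ 2]
    (fun i => by fin_cases i <;> simp)
    (fun i => by
      fin_cases i
      · simp
      · simp
      · simp [mul_assoc])
  refine ⟨b, ?_, ?_, ?_⟩
  · rw [hb]; simp [hb₀]
  · rw [hb]; simp [hb₀]
  · rw [hb, c_zero_eq_inv, inv_inv]; simp [hb₀]

end Literature.GroupTheory.CombinatorialGroupTheory.PuncturedSurfaceGroup
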